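import Literature.Analysis.FluidPDE.OseenSlice
import Literature.Analysis.FluidPDE.NSBoundedMildOseen
import Literature.Analysis.FluidPDE.LerayVolterraComparison
import Mathlib.Analysis.SpecialFunctions.ExpDeriv
import Mathlib.MeasureTheory.Integral.IntervalIntegral.FundThmCalculus
import HarnessLib

/-!
# Calculus of the Oseen–Duhamel bilinear term `B_{t₀}(a, b)(t)` on a time window, for GENERAL
  pairs of bounded measurable fields

Analysis/FluidPDE support file (one constant chosen once, everything else proved) for the
linear step, in forcing form, of the perturbation theorem of M. P. Coiculescu, S. Palasek,
*Non-uniqueness of smooth solutions of the Navier–Stokes equations from critical data*, Invent.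
Math. 244 (2025) = arXiv:2503.14699, Props. 4.2–4.3 with App. B, Prop. B.1 (hypothesis `hB` of
`Literature.Barriers.NavierStokesRegularity.CriticalDataSmoothNonuniqueness_of_principalParts_of_perturbationThreshold`):
the linearised problem `w = Φ - B_{t₀}(v, w) - B_{t₀}(w, v)` around the principal part `v`
involves the tree's bilinear term `oseenDuhamel 1 t₀ a b t x = ∫_{τ∈(t₀,t)} N_{t-τ}[a τ, b τ](x) dτ`
(`NSBoundedMildOseen.lean`; `N_σ = oseenSlice σ`, `OseenSlice.lean`) with TWO DIFFERENT fields,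
whereas the tree's window calculus (`NSBoundedMildOseenRestart.lean`, `NSBoundedMildOseenDuhamel.lean`)
is written for the diagonal `B(w, w)` or for the initial time `0` (`KatoPicard.measurable_uncurry_oseenDuhamel`).
This file supplies the general-pair, general-initial-time versions:

* `oseenSliceConst E` — the constant `C₀` of `exists_norm_oseenSlice_le`, chosen once
  (`norm_oseenSlice_le_oseenSliceConst`: `‖N_σ[a,b](x)‖ ≤ C₀ σ^{-1/2} M_a M_b`);
* `norm_oseenDuhamel_le_setIntegral` — the sup bound with TIME-DEPENDENT slice bounds:
  `‖B_{t₀}(a,b)(t)(x)‖ ≤ C₀ ∫_{(t₀,t)} (t-τ)^{-1/2} M_a(τ) M_b(τ) dτ` (the Abel transform of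
  `M_a M_b`; Coiculescu–Palasek, proof of Prop. 4.2: `‖II‖, ‖III‖ ≲ ∫ (t-s)^{-1/2}‖v(s)‖‖S(s,t')a‖ ds`);
* `measurable_uncurry_oseenDuhamel_from` — joint measurability of `(t, x) ↦ B_{t₀}(a,b)(t)(x)`;
* `integrableOn_oseenSlice_window` — integrability of `τ ↦ N_{t-τ}[a τ, b τ](x)` on `(t₀, t)` for
  bounded jointly measurable fields, whence bilinearity of `B_{t₀}` in each slot
  (`oseenDuhamel_window_add_left/right`, `oseenDuhamel_window_sub_left/right`; the slab versions with a.e.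
  hypotheses are `KatoLocalBoundedPicard.oseenDuhamel_sub_left/right`);
* `setIntegral_abelKernel_mul_exp_le` — the exponential-weight estimate
  `∫_{(t₀,t)} (t-τ)^{-1/2} e^{λ(τ-t₀)} dτ ≤ 3 λ^{-1/2} e^{λ(t-t₀)}` (`λ > 0`), which makes the
  linear Volterra map a contraction in the weighted sup norm `sup e^{-λ(t-t₀)}‖w(t)‖_∞` on a
  window where `v` is bounded (App. B, Prop. B.1: existence for the perturbed Stokes system).

## Mathlib / tree search

Tree: `oseenSlice`, `exists_norm_oseenSlice_le`, `integrable_oseenKernel_slice_of_bound`,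
`oseenSlice_add_left/right`, `oseenSlice_sub_left/right`, `stronglyMeasurable_oseenSlice_duhamel`
(`OseenSlice.lean`); `oseenDuhamel` (`NSBoundedMildOseen.lean`); `measurable_oseenKernel`
(`KochTataruKernel.lean`); `integrableOn_sub_rpow_Ioo`, `setIntegral_Ioo_sub_rpow_neg_half`,
`measurable_sub_rpow_const` (`LerayVolterraComparison.lean`). Mathlib:
`MeasureTheory.norm_integral_le_of_norm_le`, `StronglyMeasurable.integral_prod_right'`,
`intervalIntegral.integral_eq_sub_of_hasDerivAt`.

## References

* M. P. Coiculescu, S. Palasek, Invent. Math. 244 (2025) = arXiv:2503.14699: proof of Prop. 4.2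
  (terms `II`, `III`), App. B, Prop. B.1. [`CoiculescuPalasek2025`]
* G. Koch, N. Nadirashvili, G. Seregin, V. Šverák, Acta Math. 203 (2009) = arXiv:0709.3599,
  §4 p. 8 (the bilinear form `B(u, v)` and its bound). [`KochNadirashviliSereginSverak2009`]
-/

noncomputable section

open MeasureTheory Set Function Filter
open _root_.Topology
open scoped ENNReal

namespace Literature.Analysis.FluidPDE

variable {E : Type*} [NormedAddCommGroup E] [InnerProductSpace ℝ E] [FiniteDimensional ℝ E]
  [MeasurableSpace E] [BorelSpace E]

/-! ### The slice constant, chosen once -/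

variable (E) in
/-- **The slice constant `C₀ = C₀(E)`** of `exists_norm_oseenSlice_le`:
`‖N_σ[a, b](x)‖ ≤ C₀ σ^{-1/2} M_a M_b` (KNSS 2009, §3 (3.5), §4 p. 8), chosen once so that all
windows of the dyadic construction use the same constant. [cite: KochNadirashviliSereginSverak2009, §3 (3.5) and §4 p. 8 (arXiv:0709.3599v1)] -/
def oseenSliceConst : ℝ := Classical.choose (exists_norm_oseenSlice_le (E := E))

/-- `C₀ > 0`. [folklore] -/
theorem oseenSliceConst_pos : 0 < oseenSliceConst E :=
  (Classical.choose_spec (exists_norm_oseenSlice_le (E := E))).1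

/-- **The slice bound with the chosen constant**: `‖N_σ[a, b](x)‖ ≤ C₀ σ^{-1/2} M_a M_b` for
`σ > 0` and fields bounded by `M_a`, `M_b` (no measurability needed). [cite: KochNadirashviliSereginSverak2009, §3 (3.5) and §4 p. 8 (arXiv:0709.3599v1)] -/
theorem norm_oseenSlice_le_oseenSliceConst {σ : ℝ} (hσ : 0 < σ) {a b : E → E} {Ma Mb : ℝ}
    (ha : ∀ y, ‖a y‖ ≤ Ma) (hb : ∀ y, ‖b y‖ ≤ Mb) (x : E) :
    ‖oseenSlice σ a b x‖ ≤ oseenSliceConst E * σ ^ (-(1 / 2 : ℝ)) * Ma * Mb :=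
  (Classical.choose_spec (exists_norm_oseenSlice_le (E := E))).2 hσ ha hb x

/-! ### The sup bound of the bilinear term with time-dependent slice bounds -/

/-- `B^1_{t₀}(a, b)(t)(x) = ∫_{(t₀,t)} N_{t-τ}[a τ, b τ](x) dτ` (viscosity `1`). [folklore] -/
theorem oseenDuhamel_one_eq_setIntegral_oseenSlice (t₀ : ℝ) (a b : ℝ → E → E) (t : ℝ) (x : E) :
    oseenDuhamel 1 t₀ a b t x = ∫ τ in Ioo t₀ t, oseenSlice (t - τ) (a τ) (b τ) x := by
  rw [oseenDuhamel_apply]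
  refine setIntegral_congr_fun measurableSet_Ioo fun τ _ => ?_
  rw [one_mul, oseenSlice_apply]

/-- **Sup bound of the bilinear term with time-dependent slice bounds** (the mechanism of the
terms `II`, `III` in the proof of Prop. 4.2 of Coiculescu–Palasek:
`‖∫ e^{(t-s)Δ}ℙ∇·(v ⊙ S)‖ ≲ ∫ (t-s)^{-1/2}‖v(s)‖_∞‖S(s)‖_∞ ds`). If `‖a τ y‖ ≤ M_a(τ)` and
`‖b τ y‖ ≤ M_b(τ)` for `τ ∈ (t₀, t)` and `τ ↦ (t-τ)^{-1/2} M_a(τ) M_b(τ)` is integrable on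
`(t₀, t)`, then `‖B_{t₀}(a,b)(t)(x)‖ ≤ C₀ ∫_{(t₀,t)} (t-τ)^{-1/2} M_a(τ) M_b(τ) dτ`. No
measurability of `a, b` is needed (`norm_integral_le_of_norm_le`). [cite: CoiculescuPalasek2025, proof of Prop. 4.2 (terms II, III)] -/
theorem norm_oseenDuhamel_le_setIntegral {t₀ t : ℝ} {a b : ℝ → E → E} {Ma Mb : ℝ → ℝ}
    (ha : ∀ τ ∈ Ioo t₀ t, ∀ y, ‖a τ y‖ ≤ Ma τ) (hb : ∀ τ ∈ Ioo t₀ t, ∀ y, ‖b τ y‖ ≤ Mb τ)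
    (hint : IntegrableOn (fun τ => (t - τ) ^ (-(1 / 2 : ℝ)) * (Ma τ * Mb τ)) (Ioo t₀ t)) (x : E) :
    ‖oseenDuhamel 1 t₀ a b t x‖ ≤
      oseenSliceConst E * ∫ τ in Ioo t₀ t, (t - τ) ^ (-(1 / 2 : ℝ)) * (Ma τ * Mb τ) := by
  rw [oseenDuhamel_one_eq_setIntegral_oseenSlice, ← integral_const_mul]
  refine norm_integral_le_of_norm_le (hint.const_mul _) ?_
  filter_upwards [ae_restrict_mem measurableSet_Ioo] with τ hτ
  have hσ : 0 < t - τ := sub_pos.2 hτ.2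
  calc ‖oseenSlice (t - τ) (a τ) (b τ) x‖
      ≤ oseenSliceConst E * (t - τ) ^ (-(1 / 2 : ℝ)) * Ma τ * Mb τ :=
        norm_oseenSlice_le_oseenSliceConst hσ (ha τ hτ) (hb τ hτ) x
    _ = oseenSliceConst E * ((t - τ) ^ (-(1 / 2 : ℝ)) * (Ma τ * Mb τ)) := by ring

/-- **Sup bound with constant slice bounds**: `‖B_{t₀}(a,b)(t)(x)‖ ≤ C₀ M_a M_b · 2√(t - t₀)` for
`t₀ ≤ t` (KNSS 2009, §4 p. 8: `‖B(u,v)‖ ≤ C√T‖u‖‖v‖`). [cite: KochNadirashviliSereginSverak2009, §4 p. 8 (arXiv:0709.3599v1)] -/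
theorem norm_oseenDuhamel_le_const {t₀ t : ℝ} (ht : t₀ ≤ t) {a b : ℝ → E → E} {Ma Mb : ℝ}
    (ha : ∀ τ ∈ Ioo t₀ t, ∀ y, ‖a τ y‖ ≤ Ma) (hb : ∀ τ ∈ Ioo t₀ t, ∀ y, ‖b τ y‖ ≤ Mb) (x : E) :
    ‖oseenDuhamel 1 t₀ a b t x‖ ≤ oseenSliceConst E * (Ma * Mb) * (2 * Real.sqrt (t - t₀)) := by
  have hk : IntegrableOn (fun τ : ℝ => (t - τ) ^ (-(1 / 2 : ℝ))) (Ioo t₀ t) :=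
    integrableOn_sub_rpow_Ioo (by norm_num)
  refine (norm_oseenDuhamel_le_setIntegral ha hb (hk.mul_const _) x).trans (le_of_eq ?_)
  rw [integral_mul_const, setIntegral_Ioo_sub_rpow_neg_half ht, ← Real.sqrt_eq_rpow]
  ring

/-! ### Joint measurability of the bilinear term from a general initial time -/

/-- **Joint measurability of `(t, x) ↦ B_{t₀}(a, b)(t)(x)`** for jointly measurable `a`, `b`
(the time integral as an integral over `ℝ` of the indicator of `{t₀ < τ < t}` times the jointly
measurable inner integral; `StronglyMeasurable.integral_prod_right'` twice — the proof of the
tree's `KatoPicard.measurable_uncurry_oseenDuhamel` for a general initial time `t₀`). [folklore] -/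
theorem measurable_uncurry_oseenDuhamel_from {a b : ℝ → E → E} (ham : Measurable (uncurry a))
    (hbm : Measurable (uncurry b)) (ν t₀ : ℝ) :
    Measurable (uncurry fun (t : ℝ) (x : E) => oseenDuhamel ν t₀ a b t x) := by
  have ha' : Measurable (fun q : ((ℝ × E) × ℝ) × E => a q.1.2 q.2) :=
    ham.comp (measurable_fst.snd.prodMk measurable_snd)
  have hb' : Measurable (fun q : ((ℝ × E) × ℝ) × E => b q.1.2 q.2) :=
    hbm.comp (measurable_fst.snd.prodMk measurable_snd)
  have hk : Measurable (fun q : ((ℝ × E) × ℝ) × E =>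
      oseenKernel (ν * (q.1.1.1 - q.1.2)) (q.1.1.2 - q.2) (a q.1.2 q.2) (b q.1.2 q.2)) :=
    Measurable.oseenKernel_comp (measurable_const.mul (measurable_fst.fst.fst.sub measurable_fst.snd))
      (measurable_fst.fst.snd.sub measurable_snd) ha' hb'
  have hFm := hk.stronglyMeasurable.integral_prod_right' (ν := (volume : Measure E))
  dsimp only [Function.comp_def] at hFm
  have hset : MeasurableSet {p : (ℝ × E) × ℝ | p.2 ∈ Ioo t₀ p.1.1} := by
    have h1 : MeasurableSet {p : (ℝ × E) × ℝ | t₀ < p.2} := measurableSet_lt measurable_const measurable_snd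
    have h2 : MeasurableSet {p : (ℝ × E) × ℝ | p.2 < p.1.1} :=
      measurableSet_lt measurable_snd measurable_fst.fst
    exact h1.inter h2
  have hGm := hFm.indicator hset
  have hB := hGm.integral_prod_right' (ν := (volume : Measure ℝ))
  have heq : (uncurry fun (t : ℝ) (x : E) => oseenDuhamel ν t₀ a b t x) =
      fun q : ℝ × E => ∫ τ, ({p : (ℝ × E) × ℝ | p.2 ∈ Ioo t₀ p.1.1}).indicator
        (fun p : (ℝ × E) × ℝ => ∫ y, oseenKernel (ν * (p.1.1 - p.2)) (p.1.2 - y) (a p.2 y) (b p.2 y))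
          (q, τ) := by
    funext q
    have h1 : (fun τ => ({p : (ℝ × E) × ℝ | p.2 ∈ Ioo t₀ p.1.1}).indicator
        (fun p : (ℝ × E) × ℝ => ∫ y, oseenKernel (ν * (p.1.1 - p.2)) (p.1.2 - y) (a p.2 y) (b p.2 y))
          (q, τ)) = (Ioo t₀ q.1).indicator fun τ =>
            ∫ y, oseenKernel (ν * (q.1 - τ)) (q.2 - y) (a τ y) (b τ y) := by
      funext τ
      by_cases hτ : τ ∈ Ioo t₀ q.1
      · rw [indicator_of_mem hτ, indicator_of_mem
          (show (q, τ) ∈ {p : (ℝ × E) × ℝ | p.2 ∈ Ioo t₀ p.1.1} from hτ)]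
      · rw [indicator_of_notMem hτ, indicator_of_notMem
          (show (q, τ) ∉ {p : (ℝ × E) × ℝ | p.2 ∈ Ioo t₀ p.1.1} from hτ)]
    show oseenDuhamel ν t₀ a b q.1 q.2 = _
    rw [h1, integral_indicator measurableSet_Ioo, oseenDuhamel_apply]
  rw [heq]
  exact hB.measurable

/-! ### Integrability of the window integrand and bilinearity in each slot -/

/-- **Integrability of the window integrand**: for jointly measurable fields bounded by `M_a`,
`M_b` on the slab `(t₀, t) × E`, `τ ↦ N_{t-τ}[a τ, b τ](x)` is integrable on `(t₀, t)` (measurable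
by `stronglyMeasurable_oseenSlice_duhamel`, dominated by `C₀ M_a M_b (t-τ)^{-1/2}`). [folklore] -/
theorem integrableOn_oseenSlice_window {t₀ t : ℝ} {a b : ℝ → E → E} {Ma Mb : ℝ}
    (ham : Measurable (uncurry a)) (hbm : Measurable (uncurry b))
    (ha : ∀ τ ∈ Ioo t₀ t, ∀ y, ‖a τ y‖ ≤ Ma) (hb : ∀ τ ∈ Ioo t₀ t, ∀ y, ‖b τ y‖ ≤ Mb) (x : E) :
    IntegrableOn (fun τ => oseenSlice (t - τ) (a τ) (b τ) x) (Ioo t₀ t) := by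
  have hm : AEStronglyMeasurable (fun τ => oseenSlice (t - τ) (a τ) (b τ) x)
      (volume.restrict (Ioo t₀ t)) := by
    have h := stronglyMeasurable_oseenSlice_duhamel 1 t ham hbm
    have h' : StronglyMeasurable (fun τ : ℝ => oseenSlice (1 * (t - τ)) (a τ) (b τ) x) :=
      h.comp_measurable (measurable_id.prodMk measurable_const)
    simp only [one_mul] at h'
    exact h'.aestronglyMeasurable.restrict
  have hk : IntegrableOn (fun τ : ℝ => (t - τ) ^ (-(1 / 2 : ℝ))) (Ioo t₀ t) :=
    integrableOn_sub_rpow_Ioo (by norm_num)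
  refine Integrable.mono' ((hk.const_mul (oseenSliceConst E)).mul_const (Ma * Mb)) hm ?_
  filter_upwards [ae_restrict_mem measurableSet_Ioo] with τ hτ
  calc ‖oseenSlice (t - τ) (a τ) (b τ) x‖
      ≤ oseenSliceConst E * (t - τ) ^ (-(1 / 2 : ℝ)) * Ma * Mb :=
        norm_oseenSlice_le_oseenSliceConst (sub_pos.2 hτ.2) (ha τ hτ) (hb τ hτ) x
    _ = oseenSliceConst E * (t - τ) ^ (-(1 / 2 : ℝ)) * (Ma * Mb) := by ring

/-- Integrability of each slice integrand `y ↦ K(t-τ, x-y)[a τ y, b τ y]`, `τ ∈ (t₀, t)`.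
[folklore] -/
theorem integrable_oseenKernel_window_slice {t₀ t : ℝ} {a b : ℝ → E → E} {Ma Mb : ℝ}
    (ham : Measurable (uncurry a)) (hbm : Measurable (uncurry b))
    (ha : ∀ τ ∈ Ioo t₀ t, ∀ y, ‖a τ y‖ ≤ Ma) (hb : ∀ τ ∈ Ioo t₀ t, ∀ y, ‖b τ y‖ ≤ Mb)
    {τ : ℝ} (hτ : τ ∈ Ioo t₀ t) (x : E) :
    Integrable (fun y => oseenKernel (t - τ) (x - y) (a τ y) (b τ y)) volume :=
  integrable_oseenKernel_slice_of_bound (sub_pos.2 hτ.2)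
    ham.of_uncurry_left.aestronglyMeasurable
    hbm.of_uncurry_left.aestronglyMeasurable (ha τ hτ) (hb τ hτ) x

section Bilinear

variable {t₀ t : ℝ} {a a' b b' : ℝ → E → E} {Ma Ma' Mb Mb' : ℝ}

/-- **Additivity in the left slot**: `B_{t₀}(a + a', b)(t) = B_{t₀}(a, b)(t) + B_{t₀}(a', b)(t)`
for bounded jointly measurable fields. [folklore] -/
theorem oseenDuhamel_window_add_left (ham : Measurable (uncurry a)) (ha'm : Measurable (uncurry a'))
    (hbm : Measurable (uncurry b)) (ha : ∀ τ ∈ Ioo t₀ t, ∀ y, ‖a τ y‖ ≤ Ma)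
    (ha' : ∀ τ ∈ Ioo t₀ t, ∀ y, ‖a' τ y‖ ≤ Ma') (hb : ∀ τ ∈ Ioo t₀ t, ∀ y, ‖b τ y‖ ≤ Mb) (x : E) :
    oseenDuhamel 1 t₀ (a + a') b t x = oseenDuhamel 1 t₀ a b t x + oseenDuhamel 1 t₀ a' b t x := by
  rw [oseenDuhamel_one_eq_setIntegral_oseenSlice, oseenDuhamel_one_eq_setIntegral_oseenSlice,
    oseenDuhamel_one_eq_setIntegral_oseenSlice,
    ← integral_add (integrableOn_oseenSlice_window ham hbm ha hb x)
      (integrableOn_oseenSlice_window ha'm hbm ha' hb x)]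
  refine setIntegral_congr_fun measurableSet_Ioo fun τ hτ => ?_
  exact oseenSlice_add_left (integrable_oseenKernel_window_slice ham hbm ha hb hτ x)
    (integrable_oseenKernel_window_slice ha'm hbm ha' hb hτ x)

/-- **Additivity in the right slot**: `B_{t₀}(a, b + b')(t) = B_{t₀}(a, b)(t) + B_{t₀}(a, b')(t)`
for bounded jointly measurable fields. [folklore] -/
theorem oseenDuhamel_window_add_right (ham : Measurable (uncurry a)) (hbm : Measurable (uncurry b))
    (hb'm : Measurable (uncurry b')) (ha : ∀ τ ∈ Ioo t₀ t, ∀ y, ‖a τ y‖ ≤ Ma)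
    (hb : ∀ τ ∈ Ioo t₀ t, ∀ y, ‖b τ y‖ ≤ Mb) (hb' : ∀ τ ∈ Ioo t₀ t, ∀ y, ‖b' τ y‖ ≤ Mb') (x : E) :
    oseenDuhamel 1 t₀ a (b + b') t x = oseenDuhamel 1 t₀ a b t x + oseenDuhamel 1 t₀ a b' t x := by
  rw [oseenDuhamel_one_eq_setIntegral_oseenSlice, oseenDuhamel_one_eq_setIntegral_oseenSlice,
    oseenDuhamel_one_eq_setIntegral_oseenSlice,
    ← integral_add (integrableOn_oseenSlice_window ham hbm ha hb x)
      (integrableOn_oseenSlice_window ham hb'm ha hb' x)]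
  refine setIntegral_congr_fun measurableSet_Ioo fun τ hτ => ?_
  exact oseenSlice_add_right (integrable_oseenKernel_window_slice ham hbm ha hb hτ x)
    (integrable_oseenKernel_window_slice ham hb'm ha hb' hτ x)

/-- **Subtraction in the left slot**: `B_{t₀}(a - a', b)(t) = B_{t₀}(a, b)(t) - B_{t₀}(a', b)(t)`.
[folklore] -/
theorem oseenDuhamel_window_sub_left (ham : Measurable (uncurry a)) (ha'm : Measurable (uncurry a'))
    (hbm : Measurable (uncurry b)) (ha : ∀ τ ∈ Ioo t₀ t, ∀ y, ‖a τ y‖ ≤ Ma)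
    (ha' : ∀ τ ∈ Ioo t₀ t, ∀ y, ‖a' τ y‖ ≤ Ma') (hb : ∀ τ ∈ Ioo t₀ t, ∀ y, ‖b τ y‖ ≤ Mb) (x : E) :
    oseenDuhamel 1 t₀ (a - a') b t x = oseenDuhamel 1 t₀ a b t x - oseenDuhamel 1 t₀ a' b t x := by
  rw [oseenDuhamel_one_eq_setIntegral_oseenSlice, oseenDuhamel_one_eq_setIntegral_oseenSlice,
    oseenDuhamel_one_eq_setIntegral_oseenSlice,
    ← integral_sub (integrableOn_oseenSlice_window ham hbm ha hb x)
      (integrableOn_oseenSlice_window ha'm hbm ha' hb x)]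
  refine setIntegral_congr_fun measurableSet_Ioo fun τ hτ => ?_
  exact oseenSlice_sub_left (integrable_oseenKernel_window_slice ham hbm ha hb hτ x)
    (integrable_oseenKernel_window_slice ha'm hbm ha' hb hτ x)

/-- **Subtraction in the right slot**: `B_{t₀}(a, b - b')(t) = B_{t₀}(a, b)(t) - B_{t₀}(a, b')(t)`.
[folklore] -/
theorem oseenDuhamel_window_sub_right (ham : Measurable (uncurry a)) (hbm : Measurable (uncurry b))
    (hb'm : Measurable (uncurry b')) (ha : ∀ τ ∈ Ioo t₀ t, ∀ y, ‖a τ y‖ ≤ Ma)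
    (hb : ∀ τ ∈ Ioo t₀ t, ∀ y, ‖b τ y‖ ≤ Mb) (hb' : ∀ τ ∈ Ioo t₀ t, ∀ y, ‖b' τ y‖ ≤ Mb') (x : E) :
    oseenDuhamel 1 t₀ a (b - b') t x = oseenDuhamel 1 t₀ a b t x - oseenDuhamel 1 t₀ a b' t x := by
  rw [oseenDuhamel_one_eq_setIntegral_oseenSlice, oseenDuhamel_one_eq_setIntegral_oseenSlice,
    oseenDuhamel_one_eq_setIntegral_oseenSlice,
    ← integral_sub (integrableOn_oseenSlice_window ham hbm ha hb x)
      (integrableOn_oseenSlice_window ham hb'm ha hb' x)]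
  refine setIntegral_congr_fun measurableSet_Ioo fun τ hτ => ?_
  exact oseenSlice_sub_right (integrable_oseenKernel_window_slice ham hbm ha hb hτ x)
    (integrable_oseenKernel_window_slice ham hb'm ha hb' hτ x)

end Bilinear

/-! ### The exponential weight -/

/-- **The exponential-weight estimate**: for `λ > 0` and `t₀ ≤ t`,
`∫_{(t₀,t)} (t-τ)^{-1/2} e^{λ(τ-t₀)} dτ ≤ 3 λ^{-1/2} e^{λ(t-t₀)}`. Split at `c = t₀ ∨ (t - 1/λ)`: on
`(c, t)` the weight is at most `e^{λ(t-t₀)}` and the kernel integrates to `2√(t-c) ≤ 2λ^{-1/2}`;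
on `(t₀, c]` the kernel is at most `λ^{1/2}` and `∫ e^{λ(τ-t₀)} ≤ e^{λ(c-t₀)}/λ = e^{λ(t-t₀)}/(eλ)`.
It makes `w ↦ B_{t₀}(v, w) + B_{t₀}(w, v)` a contraction in the weighted sup norm with weight
`e^{-λ(t-t₀)}` for `λ` large against `‖v‖_∞` (App. B, Prop. B.1 of Coiculescu–Palasek: existence
for the linearised system). [cite: CoiculescuPalasek2025, App. B, Prop. B.1] -/
theorem setIntegral_abelKernel_mul_exp_le {t₀ t lam : ℝ} (hlam : 0 < lam) (ht : t₀ ≤ t) :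
    ∫ τ in Ioo t₀ t, (t - τ) ^ (-(1 / 2 : ℝ)) * Real.exp (lam * (τ - t₀)) ≤
      3 * lam ^ (-(1 / 2 : ℝ)) * Real.exp (lam * (t - t₀)) := by
  set c : ℝ := max t₀ (t - 1 / lam) with hc
  have ht₀c : t₀ ≤ c := le_max_left _ _
  have hct : c ≤ t := max_le ht (by rw [sub_le_self_iff]; positivity)
  have hct' : t - c ≤ 1 / lam := by
    have : t - 1 / lam ≤ c := le_max_right _ _
    linarith
  have hlam12 : lam ^ (-(1 / 2 : ℝ)) = (Real.sqrt lam)⁻¹ := by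
    rw [Real.rpow_neg hlam.le, Real.sqrt_eq_rpow]
  have hsl : 0 < Real.sqrt lam := Real.sqrt_pos.2 hlam
  have hE : 0 < Real.exp (lam * (t - t₀)) := Real.exp_pos _
  -- the integrand and its integrability
  set f : ℝ → ℝ := fun τ => (t - τ) ^ (-(1 / 2 : ℝ)) * Real.exp (lam * (τ - t₀)) with hf
  have hk : IntegrableOn (fun τ : ℝ => (t - τ) ^ (-(1 / 2 : ℝ))) (Ioo t₀ t) :=
    integrableOn_sub_rpow_Ioo (by norm_num)
  have hexp_le : ∀ τ ∈ Ioo t₀ t, Real.exp (lam * (τ - t₀)) ≤ Real.exp (lam * (t - t₀)) :=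
    fun τ hτ => Real.exp_le_exp.2 (by nlinarith [hτ.2.le])
  have hexp_cont : Continuous fun τ : ℝ => Real.exp (lam * (τ - t₀)) := by fun_prop
  have hfI : IntegrableOn f (Ioo t₀ t) := by
    refine Integrable.mono' (hk.mul_const (Real.exp (lam * (t - t₀)))) ?_ ?_
    · exact ((measurable_sub_rpow_const t _).aestronglyMeasurable.mul
        hexp_cont.aestronglyMeasurable).restrict
    · filter_upwards [ae_restrict_mem measurableSet_Ioo] with τ hτ
      have hk0 : 0 ≤ (t - τ) ^ (-(1 / 2 : ℝ)) := Real.rpow_nonneg (sub_nonneg.2 hτ.2.le) _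
      rw [hf, norm_mul, Real.norm_of_nonneg hk0, Real.norm_of_nonneg (Real.exp_pos _).le]
      exact mul_le_mul_of_nonneg_left (hexp_le τ hτ) hk0
  have hf0 : ∀ τ ∈ Ioo t₀ t, 0 ≤ f τ := fun τ hτ =>
    mul_nonneg (Real.rpow_nonneg (sub_nonneg.2 hτ.2.le) _) (Real.exp_pos _).le
  -- split at `c`
  have hsplit : ∫ τ in Ioo t₀ t, f τ = (∫ τ in Ioo t₀ c, f τ) + ∫ τ in Ico c t, f τ := by
    rcases ht₀c.eq_or_lt with heq | hlt
    · rw [← heq, Ioo_self, Measure.restrict_empty, integral_zero_measure, zero_add,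
        setIntegral_congr_set (Ioo_ae_eq_Ico (μ := (volume : Measure ℝ)))]
    rcases hct.eq_or_lt with heq' | hlt'
    · rw [heq', Ico_self, Measure.restrict_empty, integral_zero_measure, add_zero]
    have hdisj : Disjoint (Ioo t₀ c) (Ico c t) :=
      (Set.Iio_disjoint_Ici le_rfl).mono Ioo_subset_Iio_self Ico_subset_Ici_self
    rw [← Ioo_union_Ico_eq_Ioo hlt hct, setIntegral_union hdisj measurableSet_Ico
      (hfI.mono_set (Ioo_subset_Ioo le_rfl hct)) (hfI.mono_set (Ico_subset_Ioo_left hlt))]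
  -- the piece near `t`
  have hnear : ∫ τ in Ico c t, f τ ≤ 2 * (Real.sqrt lam)⁻¹ * Real.exp (lam * (t - t₀)) := by
    rw [setIntegral_congr_set (Ioo_ae_eq_Ico (μ := (volume : Measure ℝ))).symm]
    have hkc : IntegrableOn (fun τ : ℝ => (t - τ) ^ (-(1 / 2 : ℝ))) (Ioo c t) :=
      integrableOn_sub_rpow_Ioo (by norm_num)
    calc ∫ τ in Ioo c t, f τ
        ≤ ∫ τ in Ioo c t, (t - τ) ^ (-(1 / 2 : ℝ)) * Real.exp (lam * (t - t₀)) := by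
          refine integral_mono_of_nonneg ?_ (hkc.mul_const _) ?_
          · exact ae_restrict_of_forall_mem measurableSet_Ioo fun τ hτ =>
              hf0 τ ⟨ht₀c.trans_lt hτ.1, hτ.2⟩
          · refine ae_restrict_of_forall_mem measurableSet_Ioo fun τ hτ => ?_
            exact mul_le_mul_of_nonneg_left (hexp_le τ ⟨ht₀c.trans_lt hτ.1, hτ.2⟩)
              (Real.rpow_nonneg (sub_nonneg.2 hτ.2.le) _)
      _ = 2 * Real.sqrt (t - c) * Real.exp (lam * (t - t₀)) := by
          rw [integral_mul_const, setIntegral_Ioo_sub_rpow_neg_half hct, ← Real.sqrt_eq_rpow]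
      _ ≤ 2 * (Real.sqrt lam)⁻¹ * Real.exp (lam * (t - t₀)) := by
          gcongr
          rw [← Real.sqrt_inv]
          exact Real.sqrt_le_sqrt (by rw [← one_div]; exact hct')
  -- the piece away from `t`
  have hfar : ∫ τ in Ioo t₀ c, f τ ≤ (Real.sqrt lam)⁻¹ * Real.exp (lam * (t - t₀)) := by
    rcases ht₀c.eq_or_lt with heq | hlt
    · rw [← heq, Ioo_self, Measure.restrict_empty, integral_zero_measure]
      positivity
    -- here `c = t - 1/λ > t₀`
    have hc' : c = t - 1 / lam := by
      rcases eq_or_ne c t₀ with h | h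
      · exact absurd h hlt.ne'
      · have := max_choice t₀ (t - 1 / lam)
        rcases this with h1 | h1
        · exact absurd h1 h
        · exact h1
    have htc : t - c = 1 / lam := by rw [hc']; ring
    -- kernel bound `(t - τ)^{-1/2} ≤ λ^{1/2}` on `(t₀, c)`
    have hker : ∀ τ ∈ Ioo t₀ c, (t - τ) ^ (-(1 / 2 : ℝ)) ≤ Real.sqrt lam := by
      intro τ hτ
      have h1 : 1 / lam ≤ t - τ := by linarith [hτ.2.le]
      calc (t - τ) ^ (-(1 / 2 : ℝ)) ≤ (1 / lam) ^ (-(1 / 2 : ℝ)) :=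
            Real.rpow_le_rpow_of_nonpos (by positivity) h1 (by norm_num)
        _ = Real.sqrt lam := by
            rw [Real.rpow_neg (by positivity), one_div, Real.inv_rpow hlam.le, inv_inv,
              Real.sqrt_eq_rpow]
    -- `∫_{(t₀,c)} e^{λ(τ-t₀)} dτ = (e^{λ(c-t₀)} - 1)/λ ≤ e^{λ(t-t₀)} e^{-1} / λ ≤ e^{λ(t-t₀)}/λ`
    have hFTC : ∫ τ in Ioo t₀ c, Real.exp (lam * (τ - t₀)) =
        (Real.exp (lam * (c - t₀)) - 1) / lam := by
      rw [← integral_Ioc_eq_integral_Ioo, ← intervalIntegral.integral_of_le hlt.le]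
      have hderiv : ∀ τ ∈ uIcc t₀ c, HasDerivAt (fun σ => Real.exp (lam * (σ - t₀)) / lam)
          (Real.exp (lam * (τ - t₀))) τ := by
        intro τ _
        have h1 : HasDerivAt (fun σ : ℝ => lam * (σ - t₀)) lam τ := by
          simpa using ((hasDerivAt_id τ).sub_const t₀).const_mul lam
        have h2 := (Real.hasDerivAt_exp _).comp τ h1
        have h3 := h2.div_const lam
        exact h3.congr_deriv (by rw [mul_div_assoc, div_self hlam.ne', mul_one])
      rw [intervalIntegral.integral_eq_sub_of_hasDerivAt hderiv
        (hexp_cont.intervalIntegrable _ _)]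
      simp only [sub_self, mul_zero, Real.exp_zero]
      ring
    calc ∫ τ in Ioo t₀ c, f τ
        ≤ ∫ τ in Ioo t₀ c, Real.sqrt lam * Real.exp (lam * (τ - t₀)) := by
          refine integral_mono_of_nonneg ?_ ?_ ?_
          · exact ae_restrict_of_forall_mem measurableSet_Ioo fun τ hτ =>
              hf0 τ ⟨hτ.1, hτ.2.trans_le hct⟩
          · exact ((hexp_cont.integrableOn_Icc (a := t₀) (b := c)).mono_set
              Ioo_subset_Icc_self).const_mul _
          · refine ae_restrict_of_forall_mem measurableSet_Ioo fun τ hτ => ?_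
            exact mul_le_mul_of_nonneg_right (hker τ hτ) (Real.exp_pos _).le
      _ = Real.sqrt lam * ((Real.exp (lam * (c - t₀)) - 1) / lam) := by
          rw [integral_const_mul, hFTC]
      _ ≤ Real.sqrt lam * (Real.exp (lam * (t - t₀)) / lam) := by
          refine mul_le_mul_of_nonneg_left ?_ hsl.le
          rw [div_le_div_iff_of_pos_right hlam]
          have : Real.exp (lam * (c - t₀)) ≤ Real.exp (lam * (t - t₀)) :=
            Real.exp_le_exp.2 (by nlinarith)
          linarith
      _ = (Real.sqrt lam)⁻¹ * Real.exp (lam * (t - t₀)) := by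
          rw [mul_div_left_comm, Real.sqrt_div_self, mul_comm]
  -- assemble
  calc ∫ τ in Ioo t₀ t, f τ = (∫ τ in Ioo t₀ c, f τ) + ∫ τ in Ico c t, f τ := hsplit
    _ ≤ (Real.sqrt lam)⁻¹ * Real.exp (lam * (t - t₀)) +
          2 * (Real.sqrt lam)⁻¹ * Real.exp (lam * (t - t₀)) := add_le_add hfar hnear
    _ = 3 * lam ^ (-(1 / 2 : ℝ)) * Real.exp (lam * (t - t₀)) := by rw [hlam12]; ring

end Literature.Analysis.FluidPDE
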